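import Mathlib
import HarnessLib
import Summits.NavierStokesRegularity.NavierStokesRegularity.Theorems.UnthreadedRigidityDoorUnthreadedRigidityProfileHornMoments
import Summits.NavierStokesRegularity.NavierStokesRegularity.Theorems.UnthreadedRigidityDoorUnthreadedRigidityVirialHornDefs

/-!
# Route `UnthreadedRigidityDoor`, item `UnthreadedRigidity` (W2, stmt-NavierStokesRegularity-27585) — LINE g11-1 «VIRIAL HORN»:
# S-V `VirialNondegeneracy` BY NAME — a virial-admissible profile with vanishing virial moment is null

Prover file (W2 Lean hand ns-crc-p1 g7, DIRECTOR-NS KEY-NS #188 (1); `--supports stmt-NavierStokesRegularity-27585 --as helper`) for LINE g11-1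
«VIRIAL HORN» of planner ns-idea-6 g11 (idea-crit-4 g7 PASS, RUNG line, 2026-08-29T03:44Z; sketch
`pub/ideators/ns-idea-6/lines/UnthreadedRigidityDoor/VirialHorn_sketch.lean` sha16 046ceb385f972470; objects BY NAME in
`Theorems/UnthreadedRigidityDoorUnthreadedRigidityVirialHornDefs.lean`).

`virialNondegeneracy_holds : VirialNondegeneracy`: for `l ≥ 1` and `H` virial-admissible (`H(r) = h(r²)`, `h ∈ C^∞`, decay
`r^(l+2)|H|, r^(l+3)|H′|, r^(l+4)|H″| ≤ C` on `[1,∞)`), `∫_(0,∞) r^(2l−3) α_l[H]² = 0` forces `H ≡ 0` on `[0,∞)`.  Proof: the integrand is, on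
`(0,∞)`, the continuous non-negative function `r^(2l−3) (2r²h′(r²) + (l+1)h(r²))²` with `O(r⁻²)` decay (so the Bochner integral is an honest one —
`ProfileHorn.integrableOn_Ioi_of_decay`); a vanishing integral makes it vanish pointwise, so `α ≡ 0` on `(0,∞)`; then `(r^(l+1) h(r²))′ = r^l α = 0`
on `[0,∞)` (at the apex because `l ≥ 1`), `r^(l+1) h(r²) ≡ 0`, `h ≡ 0` on `(0,∞)` and at `0` by continuity.

HONEST LABEL: one-dimensional real analysis about a radial profile (support S-V of a RUNG line); `UnthreadedRigidity` (27585), W2 and NS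
regularity remain OPEN; nothing here is a statement about the Navier–Stokes equations.  0 kit.
-/

-- the summit and its single sub-problem share the name (CONVENTIONS §1), as in every Theorems file
set_option linter.dupNamespace false

namespace Summit.NavierStokesRegularity.NavierStokesRegularity.Theorems.UnthreadedRigidity.VirialHorn

open scoped Topology ContDiff
open Filter Set MeasureTheory
open Summit.NavierStokesRegularity.NavierStokesRegularity.Theorems.UnthreadedRigidity.ProfileHorn (E3 hasDerivAt_comp_sq deriv_profile differentiable_of_smooth smooth_deriv_of_smooth
  integrableOn_Ioi_of_decay continuous_comp_sq)

/-- the strain amplitude of degree `l` in the variable `ρ`: `α_l(r) = 2r² h′(r²) + (l+1) h(r²)` for `r > 0`. -/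
theorem strainAmpL_eq {h H : ℝ → ℝ} (hd : Differentiable ℝ h) (hH : ∀ r, 0 ≤ r → H r = h (r ^ 2)) (l : ℕ)
    {r : ℝ} (hr : 0 < r) : strainAmpL l H r = 2 * r ^ 2 * deriv h (r ^ 2) + ((l : ℝ) + 1) * h (r ^ 2) := by
  unfold strainAmpL
  rw [deriv_profile hd hH hr, hH r hr.le]
  ring

/-- decay of the virial integrand: `|r^(2l−3) α_l(r)²| ≤ ((l+2)C)²/r²` for `r ≥ 1`. -/
theorem abs_virial_integrand_le {H : ℝ → ℝ} {C : ℝ} {l : ℕ}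
    (hC : ∀ r, 1 ≤ r → r ^ (l + 2) * |H r| ≤ C ∧ r ^ (l + 3) * |deriv H r| ≤ C ∧ r ^ (l + 4) * |deriv (deriv H) r| ≤ C)
    {r : ℝ} (hr : 1 ≤ r) : |r ^ (2 * l - 3) * strainAmpL l H r ^ 2| ≤ (((l : ℝ) + 2) * C) ^ 2 / r ^ 2 := by
  have hr0 : 0 < r := lt_of_lt_of_le one_pos hr
  obtain ⟨h1, h2, -⟩ := hC r hr
  have hC0 : 0 ≤ C := le_trans (by positivity) h1
  -- `r^(l+2) |α| ≤ (l+2) C`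
  have hα : r ^ (l + 2) * |strainAmpL l H r| ≤ ((l : ℝ) + 2) * C := by
    unfold strainAmpL
    have e : r ^ (l + 2) * (r * deriv H r + ((l : ℝ) + 1) * H r)
        = r ^ (l + 3) * deriv H r + ((l : ℝ) + 1) * (r ^ (l + 2) * H r) := by ring
    rw [← abs_of_pos (pow_pos hr0 (l + 2)), ← abs_mul, e]
    calc |r ^ (l + 3) * deriv H r + ((l : ℝ) + 1) * (r ^ (l + 2) * H r)|
        ≤ |r ^ (l + 3) * deriv H r| + |((l : ℝ) + 1) * (r ^ (l + 2) * H r)| := abs_add_le _ _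
      _ = r ^ (l + 3) * |deriv H r| + ((l : ℝ) + 1) * (r ^ (l + 2) * |H r|) := by
          rw [abs_mul (r ^ (l + 3)) (deriv H r), abs_of_pos (pow_pos hr0 (l + 3)), abs_mul ((l : ℝ) + 1) _,
            abs_of_nonneg (by positivity : (0 : ℝ) ≤ (l : ℝ) + 1), abs_mul (r ^ (l + 2)) (H r),
            abs_of_pos (pow_pos hr0 (l + 2))]
      _ ≤ C + ((l : ℝ) + 1) * C := add_le_add h2 (mul_le_mul_of_nonneg_left h1 (by positivity))
      _ = ((l : ℝ) + 2) * C := by ring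
  have hα2 : (r ^ (l + 2)) ^ 2 * strainAmpL l H r ^ 2 ≤ (((l : ℝ) + 2) * C) ^ 2 := by
    rw [← mul_pow, ← sq_abs (r ^ (l + 2) * strainAmpL l H r), abs_mul, abs_of_pos (pow_pos hr0 _)]
    exact pow_le_pow_left₀ (by positivity) hα 2
  rw [abs_mul, abs_of_pos (pow_pos hr0 _), abs_of_nonneg (sq_nonneg _), le_div_iff₀ (pow_pos hr0 2)]
  have hpow : r ^ (2 * l - 3) * r ^ 2 ≤ (r ^ (l + 2)) ^ 2 := by
    rw [← pow_mul, ← pow_add]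
    exact pow_le_pow_right₀ hr (by omega)
  calc r ^ (2 * l - 3) * strainAmpL l H r ^ 2 * r ^ 2 = (r ^ (2 * l - 3) * r ^ 2) * strainAmpL l H r ^ 2 := by ring
    _ ≤ (r ^ (l + 2)) ^ 2 * strainAmpL l H r ^ 2 := mul_le_mul_of_nonneg_right hpow (sq_nonneg _)
    _ ≤ (((l : ℝ) + 2) * C) ^ 2 := hα2

/-- positivity: a continuous non-negative integrable function on `(a,∞)` with zero integral vanishes there. -/
theorem eq_zero_of_integral_eq_zero {f : ℝ → ℝ} {a : ℝ} (hf : Continuous f) (hnn : ∀ r, a < r → 0 ≤ f r)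
    (hint : IntegrableOn f (Ioi a)) (h0 : ∫ r in Ioi a, f r = 0) : ∀ r, a < r → f r = 0 := by
  intro r₁ hr₁
  by_contra hne
  have hnn' : 0 ≤ᵐ[volume.restrict (Ioi a)] f := by
    filter_upwards [ae_restrict_mem measurableSet_Ioi] with ρ hρ using hnn ρ hρ
  have hpos : 0 < ∫ r in Ioi a, f r := by
    rw [setIntegral_pos_iff_support_of_nonneg_ae hnn' hint]
    have hopen : IsOpen ({ρ : ℝ | f ρ ≠ 0} ∩ Ioi a) := (isOpen_ne_fun hf continuous_const).inter isOpen_Ioi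
    exact hopen.measure_pos volume ⟨r₁, hne, hr₁⟩
  exact (ne_of_gt hpos) h0

/-- **S-V `VirialNondegeneracy` BY NAME** (support S of LINE g11-1; «α ≡ 0 ⇒ (r^(l+1)H)′ = r^l α = 0 ⇒ r^(l+1)H constant, = 0 by regularity
at 0»). -/
theorem virialNondegeneracy_holds : VirialNondegeneracy := by
  intro l H hl hAdm hM r hr
  obtain ⟨⟨h, hh, hH⟩, C, hC⟩ := hAdm
  have hd := differentiable_of_smooth hh
  have hc0 := hh.continuous
  have hc1 := (smooth_deriv_of_smooth hh).continuous
  -- the model integrand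
  set f : ℝ → ℝ := fun ρ => ρ ^ (2 * l - 3) * (2 * ρ ^ 2 * deriv h (ρ ^ 2) + ((l : ℝ) + 1) * h (ρ ^ 2)) ^ 2 with hf
  have hfc : Continuous f := by
    simp only [hf]; fun_prop
  have hfeq : ∀ ρ, 0 < ρ → ρ ^ (2 * l - 3) * strainAmpL l H ρ ^ 2 = f ρ := by
    intro ρ hρ; simp only [hf, strainAmpL_eq hd hH l hρ]
  have hfint : IntegrableOn f (Ioi 0) := by
    refine integrableOn_Ioi_of_decay (K := (((l : ℝ) + 2) * C) ^ 2) hfc fun ρ hρ => ?_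
    rw [← hfeq ρ (lt_of_lt_of_le one_pos hρ)]
    exact abs_virial_integrand_le hC hρ
  have hM' : ∫ ρ in Ioi 0, f ρ = 0 := by
    have : virialMoment l H = ∫ ρ in Ioi 0, f ρ := by
      unfold virialMoment
      exact setIntegral_congr_fun measurableSet_Ioi fun ρ hρ => hfeq ρ hρ
    rw [← this, hM]
  -- α ≡ 0 on (0,∞)
  have hα : ∀ ρ, 0 < ρ → 2 * ρ ^ 2 * deriv h (ρ ^ 2) + ((l : ℝ) + 1) * h (ρ ^ 2) = 0 := by
    intro ρ hρ
    have h1 := eq_zero_of_integral_eq_zero hfc (fun ρ hρ => by simp only [hf]; positivity) hfint hM' ρ hρ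
    simp only [hf] at h1
    rcases mul_eq_zero.mp h1 with h2 | h2
    · exact absurd h2 (pow_ne_zero _ (ne_of_gt hρ))
    · exact pow_eq_zero_iff (n := 2) (by norm_num) |>.mp h2
  -- `(r^(l+1) h(r²))′ = r^l α`
  have hg : ∀ ρ : ℝ, HasDerivAt (fun x => x ^ (l + 1) * h (x ^ 2))
      (ρ ^ l * (2 * ρ ^ 2 * deriv h (ρ ^ 2) + ((l : ℝ) + 1) * h (ρ ^ 2))) ρ := by
    intro ρ
    have e1 : HasDerivAt (fun x : ℝ => x ^ (l + 1)) (((l + 1 : ℕ) : ℝ) * ρ ^ l) ρ := by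
      simpa using hasDerivAt_pow (l + 1) ρ
    have e2 := hasDerivAt_comp_sq hd ρ
    have key := e1.fun_mul e2
    refine (key.congr_of_eventuallyEq (Eventually.of_forall fun x => rfl)).congr_deriv ?_
    push_cast
    ring
  -- flat: `r^(l+1) h(r²) = 0` on `[0,∞)`
  have hflat : ∀ R : ℝ, 0 ≤ R → R ^ (l + 1) * h (R ^ 2) = 0 := by
    intro R hR
    have hcont : ContinuousOn (fun x => x ^ (l + 1) * h (x ^ 2)) (Icc 0 R) :=
      ((continuous_pow (l + 1)).mul (continuous_comp_sq hc0)).continuousOn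
    have hder : ∀ x ∈ Ico 0 R, HasDerivWithinAt (fun x => x ^ (l + 1) * h (x ^ 2)) 0 (Ici x) x := by
      intro x hx
      have hx' := hg x
      rcases hx.1.eq_or_lt with h0 | hpos
      · rw [← h0] at hx' ⊢
        have hl0 : l ≠ 0 := by omega
        simpa [zero_pow hl0] using hx'.hasDerivWithinAt
      · rw [hα x hpos, mul_zero] at hx'
        exact hx'.hasDerivWithinAt
    have := constant_of_has_deriv_right_zero hcont hder R ⟨hR, le_rfl⟩
    simpa using this
  -- conclude
  rw [hH r hr]
  rcases hr.eq_or_lt with h0 | hpos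
  · -- at the apex, by continuity
    rw [← h0]
    have hzero : ∀ s, 0 < s → h s = 0 := by
      intro s hs
      have h1 := hflat (Real.sqrt s) (Real.sqrt_nonneg s)
      rw [Real.sq_sqrt hs.le] at h1
      rcases mul_eq_zero.mp h1 with h2 | h2
      · exact absurd h2 (pow_ne_zero _ (ne_of_gt (Real.sqrt_pos.mpr hs)))
      · exact h2
    have ht : Tendsto h (𝓝[>] 0) (𝓝 (h 0)) := (hc0.tendsto 0).mono_left nhdsWithin_le_nhds
    have ht' : Tendsto h (𝓝[>] 0) (𝓝 0) := by
      refine tendsto_const_nhds.congr' ?_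
      filter_upwards [self_mem_nhdsWithin] with s hs using (hzero s hs).symm
    simpa using tendsto_nhds_unique ht ht'
  · have h1 := hflat r hr
    rcases mul_eq_zero.mp h1 with h2 | h2
    · exact absurd h2 (pow_ne_zero _ (ne_of_gt hpos))
    · exact h2

end Summit.NavierStokesRegularity.NavierStokesRegularity.Theorems.UnthreadedRigidity.VirialHorn
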